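import Literature.NumberTheory.LFunctions.MertensConstant
import Mathlib.Analysis.Complex.Exponential
import HarnessLib

/-!
# Mertens' theorems with rates: `∑_{p≤x} 1/p = log log x + B₁ + O(1/log x)`,
# `∏_{p≤x} (1 - 1/p)⁻¹ = e^γ log x + O(1)`

Trunk T-ANT (`NumberTheory/LFunctions`), continuing `MertensConstant.lean`, which PROVES the limit
forms of Mertens' second and third theorems (`tendsto_primeRecipSum_sub_loglog`,
`tendsto_mertensLog_sub_loglog`, `tendsto_log_mul_prod_one_sub_inv`) together with Hardy–Wright's
integral formula for the Meissel–Mertens constant (`meisselMertens_eq_integral`). Everything in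
this file is PROVED:

* `abs_primeRecipSum_sub_le` — Mertens' second theorem with its rate (Hardy–Wright Thm 427,
  (22.7.2)): `|∑_{p≤x} 1/p - log log x - B₁| ≤ 8/log x` for `x ≥ 2`
  (from the integral formula: the difference is `τ(x)/log x - ∫_x^∞ τ(t) dt/(t log² t)`, `|τ| ≤ 4`);
* `abs_mertensLog_sub_le` — the logarithmic form of the product theorem with rate:
  `|∑_{p≤x} -log(1 - 1/p) - log log x - γ| ≤ 12/log x` for `x ≥ 2` (the tail
  `∑_{p>x} (-log(1-1/p) - 1/p) ≤ 2/⌊x⌋`);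
* `mertens_formula` — **Mertens's formula as printed by Nathanson** (*Additive Number Theory: The
  Classical Bases*, GTM 164, Thm 6.8; Mertens 1874; Hardy–Wright Thm 429): there is `C` with
  `|∏_{p≤x} (1 - 1/p)⁻¹ - e^γ log x| ≤ C` for all `x ≥ 2`;
  and the relative-error form `abs_prod_one_sub_inv_mul_log_sub_one_le`:
  `|∏_{p≤x} (1 - 1/p) · e^γ log x - 1| ≤ 24/log x` for `log x ≥ 12`.

Motivation: the Mertens input of Chen's theorem (Nathanson Thm 10.3, the estimate
`V(z) = 2 𝔖(N) e^{-γ}/log z (1 + O(1/log N))`, `Literature.NumberTheory.Sieve.ChenSieveProduct`)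
needs the rate `O(1/log z)`, not only the limit.

## References

* F. Mertens, *Ein Beitrag zur analytischen Zahlentheorie*, J. reine angew. Math. 78 (1874), 46–62.
* G. H. Hardy, E. M. Wright, *An Introduction to the Theory of Numbers*, 6th ed., Thms 427–429.
  [HardyWright2008]
* M. B. Nathanson, *Additive Number Theory: The Classical Bases*, GTM 164 (1996), Thm 6.8.
  [Nathanson1996]
-/

noncomputable section

open Filter Topology Set MeasureTheory Finset Real

namespace Literature.NumberTheory.LFunctions.Mertens

/-! ### The weight integral `∫_x^∞ dt/(t log² t) = 1/log x` -/

/-- `∫_x^∞ dt/(t log² t) = 1/log x` for `x ≥ 2`. [folklore] -/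
theorem integral_Ioi_inv_div_log_sq {x : ℝ} (hx : 2 ≤ x) :
    ∫ t in Ioi x, t⁻¹ / Real.log t ^ 2 = (Real.log x)⁻¹ := by
  have hderiv : ∀ t ∈ Ioi x, HasDerivAt (fun t ↦ -(Real.log t)⁻¹) (t⁻¹ / Real.log t ^ 2) t := by
    intro t ht
    have ht2 : x < t := ht
    have ht0 : t ≠ 0 := by linarith
    have hl : Real.log t ≠ 0 := (Real.log_pos (by linarith)).ne'
    refine ((Real.hasDerivAt_log ht0).inv hl).neg.congr_deriv ?_
    ring
  have hcont : ContinuousWithinAt (fun t ↦ -(Real.log t)⁻¹) (Ici x) x :=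
    ((Real.continuousAt_log (by linarith)).inv₀ (Real.log_pos (by linarith)).ne').neg.continuousWithinAt
  have hlim : Tendsto (fun t ↦ -(Real.log t)⁻¹) atTop (𝓝 0) := by
    simpa using (tendsto_inv_atTop_zero.comp Real.tendsto_log_atTop).neg
  have hint : IntegrableOn (fun t : ℝ ↦ t⁻¹ / Real.log t ^ 2) (Ioi x) :=
    integrableOn_inv_div_log_sq.mono_set (Ioi_subset_Ioi hx)
  rw [integral_Ioi_of_hasDerivAt_of_tendsto hcont hderiv hint hlim]
  ring

/-! ### Mertens' second theorem with rate -/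

/-- **Mertens' second theorem with its rate** (Hardy–Wright Thm 427, (22.7.2)): for `x ≥ 2`,
`|∑_{p≤x} 1/p - log log x - B₁| ≤ 8/log x`. Indeed, by (22.7.3) and the integral formula for `B₁`,
the difference equals `τ(x)/log x - ∫_x^∞ τ(t) dt/(t log² t)` with `|τ| ≤ 4`.
[cite: HardyWright2008, Thm 427 (§22.7)] -/
theorem abs_primeRecipSum_sub_le {x : ℝ} (hx : 2 ≤ x) :
    |primeRecipSum x - Real.log (Real.log x) - meisselMertens| ≤ 8 / Real.log x := by
  have hlog : 0 < Real.log x := Real.log_pos (by linarith)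
  -- the exact formula for the difference
  have hI : IntegrableOn (fun t ↦ mertensTau t * (t⁻¹ / Real.log t ^ 2)) (Ioi 2) :=
    integrableOn_mertensTau_mul
  have hsplit : ∫ t in Ioi 2, mertensTau t * (t⁻¹ / Real.log t ^ 2) =
      (∫ t in Ioc 2 x, mertensTau t * (t⁻¹ / Real.log t ^ 2)) +
        ∫ t in Ioi x, mertensTau t * (t⁻¹ / Real.log t ^ 2) := by
    rw [← setIntegral_union (Set.Ioc_disjoint_Ioi le_rfl) measurableSet_Ioi
      (hI.mono_set Ioc_subset_Ioi_self) (hI.mono_set (Ioi_subset_Ioi hx)),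
      Ioc_union_Ioi_eq_Ioi hx]
  have hdiff : primeRecipSum x - Real.log (Real.log x) - meisselMertens =
      mertensTau x / Real.log x - ∫ t in Ioi x, mertensTau t * (t⁻¹ / Real.log t ^ 2) := by
    rw [meisselMertens_eq_integral, primeRecipSum_eq_add_integral hx, integral_primeLogDivSum_mul hx,
      show primeLogDivSum x = Real.log x + mertensTau x by rw [mertensTau]; ring, hsplit]
    set I₁ := ∫ t in Ioc 2 x, mertensTau t * (t⁻¹ / Real.log t ^ 2)
    set I₂ := ∫ t in Ioi x, mertensTau t * (t⁻¹ / Real.log t ^ 2)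
    field_simp
    ring
  rw [hdiff]
  -- the two pieces are each at most `4/log x`
  have h1 : |mertensTau x / Real.log x| ≤ 4 / Real.log x := by
    rw [abs_div, abs_of_pos hlog]
    exact div_le_div_of_nonneg_right (abs_mertensTau_le (by linarith)) hlog.le
  have h2 : |∫ t in Ioi x, mertensTau t * (t⁻¹ / Real.log t ^ 2)| ≤ 4 / Real.log x := by
    have hwint : IntegrableOn (fun t : ℝ ↦ t⁻¹ / Real.log t ^ 2) (Ioi x) :=
      integrableOn_inv_div_log_sq.mono_set (Ioi_subset_Ioi hx)
    have hbound : ∀ᵐ t ∂(volume.restrict (Ioi x)),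
        ‖mertensTau t * (t⁻¹ / Real.log t ^ 2)‖ ≤ 4 * (t⁻¹ / Real.log t ^ 2) := by
      rw [ae_restrict_iff' measurableSet_Ioi]
      refine Eventually.of_forall fun t ht ↦ ?_
      have ht : x < t := ht
      have hw0 : (0 : ℝ) ≤ t⁻¹ / Real.log t ^ 2 := by
        have : 0 < t := by linarith
        positivity
      rw [norm_mul, Real.norm_eq_abs, Real.norm_eq_abs, abs_of_nonneg hw0]
      exact mul_le_mul_of_nonneg_right (abs_mertensTau_le (by linarith)) hw0
    calc |∫ t in Ioi x, mertensTau t * (t⁻¹ / Real.log t ^ 2)|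
        = ‖∫ t in Ioi x, mertensTau t * (t⁻¹ / Real.log t ^ 2)‖ := rfl
      _ ≤ ∫ t in Ioi x, 4 * (t⁻¹ / Real.log t ^ 2) :=
          norm_integral_le_of_norm_le (hwint.const_mul 4) hbound
      _ = 4 / Real.log x := by
          rw [integral_const_mul, integral_Ioi_inv_div_log_sq hx, div_eq_mul_inv]
  calc |mertensTau x / Real.log x - ∫ t in Ioi x, mertensTau t * (t⁻¹ / Real.log t ^ 2)|
      ≤ |mertensTau x / Real.log x| + |∫ t in Ioi x, mertensTau t * (t⁻¹ / Real.log t ^ 2)| :=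
        abs_sub _ _
    _ ≤ 4 / Real.log x + 4 / Real.log x := add_le_add h1 h2
    _ = 8 / Real.log x := by ring

/-! ### The tail `∑_{k>n} (-log(1-1/k) - 1/k)[k prime] ≤ 2/n` -/

/-- Telescoping series: `∑_{k≥0} (1/(k+n) - 1/(k+n+1)) = 1/n` for `n ≥ 1`. [folklore] -/
theorem hasSum_inv_sub_inv_succ {n : ℕ} (hn : 1 ≤ n) :
    HasSum (fun k : ℕ ↦ 1 / ((k : ℝ) + n) - 1 / ((k : ℝ) + n + 1)) (1 / (n : ℝ)) := by
  have hn' : (1 : ℝ) ≤ n := by exact_mod_cast hn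
  have hnonneg : ∀ k : ℕ, 0 ≤ 1 / ((k : ℝ) + n) - 1 / ((k : ℝ) + n + 1) := fun k ↦ by
    have : (0 : ℝ) < (k : ℝ) + n := by positivity
    rw [sub_nonneg]
    exact one_div_le_one_div_of_le this (by linarith)
  rw [hasSum_iff_tendsto_nat_of_nonneg hnonneg]
  have hpartial : ∀ K : ℕ, ∑ k ∈ Finset.range K, (1 / ((k : ℝ) + n) - 1 / ((k : ℝ) + n + 1)) =
      1 / (n : ℝ) - 1 / ((K : ℝ) + n) := by
    intro K
    induction K with
    | zero => simp
    | succ K ih =>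
      rw [Finset.sum_range_succ, ih]
      push_cast
      ring
  simp_rw [hpartial]
  have h : Tendsto (fun K : ℕ ↦ 1 / ((K : ℝ) + n)) atTop (𝓝 0) := by
    have h1 : Tendsto (fun K : ℕ ↦ (K : ℝ) + n) atTop atTop :=
      tendsto_atTop_add_const_right _ _ tendsto_natCast_atTop_atTop
    have h2 := h1.inv_tendsto_atTop
    simp only [one_div]
    exact h2
  simpa using (tendsto_const_nhds (x := 1 / (n : ℝ))).sub h

/-- The tail of `∑_k d_k`, `d_k = (-log(1 - 1/k) - 1/k)[k prime]`: for `n ≥ 1`,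
`0 ≤ ∑_k d_k - ∑_{k ≤ n} d_k ≤ 2/n` (terms `≤ 2/k² ≤ 2 (1/(k-1) - 1/k)`).
[cite: HardyWright2008, §22.7 eq. (22.7.1)] -/
theorem tsum_primeLogCoeffSubInv_sub_sum {n : ℕ} (hn : 1 ≤ n) :
    0 ≤ ∑' k, primeLogCoeffSubInv k - ∑ k ∈ Finset.range (n + 1), primeLogCoeffSubInv k ∧
      ∑' k, primeLogCoeffSubInv k - ∑ k ∈ Finset.range (n + 1), primeLogCoeffSubInv k ≤
        2 / (n : ℝ) := by
  have hs := summable_primeLogCoeffSubInv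
  have htail : ∑' k, primeLogCoeffSubInv k - ∑ k ∈ Finset.range (n + 1), primeLogCoeffSubInv k =
      ∑' k, primeLogCoeffSubInv (k + (n + 1)) := by
    rw [← hs.sum_add_tsum_nat_add (n + 1)]
    ring
  rw [htail]
  have hnonneg : ∀ k, 0 ≤ primeLogCoeffSubInv k := fun k ↦ by
    by_cases hk : k.Prime
    · have h := Literature.NumberTheory.LFunctions.Nicolas.inv_le_primeLogCoeff hk
      rw [Literature.NumberTheory.LFunctions.Nicolas.primeLogCoeff_of_prime hk] at h
      simp only [primeLogCoeffSubInv, if_pos hk]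
      linarith
    · simp [primeLogCoeffSubInv, hk]
  have hle : ∀ k : ℕ, primeLogCoeffSubInv (k + (n + 1)) ≤
      2 * (1 / ((k : ℝ) + n) - 1 / ((k : ℝ) + n + 1)) := fun k ↦ by
    have hm1 : (1 : ℝ) ≤ (k : ℝ) + n := by
      have : (1 : ℝ) ≤ n := by exact_mod_cast hn
      have : (0 : ℝ) ≤ k := Nat.cast_nonneg k
      linarith
    have hbound : primeLogCoeffSubInv (k + (n + 1)) ≤ 2 / (((k + (n + 1) : ℕ) : ℝ)) ^ 2 := by
      by_cases hk : (k + (n + 1)).Prime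
      · have h := Literature.NumberTheory.LFunctions.Nicolas.abs_primeLogCoeff_sub_inv_le hk
        rw [Literature.NumberTheory.LFunctions.Nicolas.primeLogCoeff_of_prime hk] at h
        simp only [primeLogCoeffSubInv, if_pos hk]
        exact (le_abs_self _).trans h
      · simp only [primeLogCoeffSubInv, if_neg hk]
        positivity
    refine hbound.trans ?_
    have h0 : (0 : ℝ) < (k : ℝ) + n := by linarith
    have hid : 1 / ((k : ℝ) + n) - 1 / ((k : ℝ) + n + 1) = 1 / (((k : ℝ) + n) * ((k : ℝ) + n + 1)) := by
      field_simp
      ring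
    rw [hid, mul_one_div, show (((k + (n + 1) : ℕ) : ℝ)) = (k : ℝ) + n + 1 by push_cast; ring]
    apply div_le_div_of_nonneg_left (by norm_num) (by positivity)
    nlinarith
  have hs' : Summable fun k : ℕ ↦ primeLogCoeffSubInv (k + (n + 1)) :=
    (summable_nat_add_iff (n + 1)).mpr hs
  have htele := hasSum_inv_sub_inv_succ hn
  refine ⟨tsum_nonneg fun k ↦ hnonneg _, ?_⟩
  calc ∑' k, primeLogCoeffSubInv (k + (n + 1))
      ≤ ∑' k : ℕ, 2 * (1 / ((k : ℝ) + n) - 1 / ((k : ℝ) + n + 1)) :=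
        hs'.tsum_le_tsum hle (htele.mul_left 2).summable
    _ = 2 * (1 / (n : ℝ)) := (htele.mul_left 2).tsum_eq
    _ = 2 / (n : ℝ) := by ring

/-! ### The logarithmic form with rate, and Mertens's formula -/

/-- **Logarithmic Mertens with rate**: for `x ≥ 2`,
`|∑_{p≤x} -log(1 - 1/p) - log log x - γ| ≤ 12/log x`
(Mertens' second theorem with rate, the identity `γ - B₁ = ∑_p (-log(1-1/p) - 1/p)` of
Hardy–Wright Thm 428, and the tail bound `2/⌊x⌋ ≤ 4/log x`). [cite: HardyWright2008, Thm 429 (§22.8)] -/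
theorem abs_mertensLog_sub_le {x : ℝ} (hx : 2 ≤ x) :
    |Literature.NumberTheory.LFunctions.Nicolas.mertensLog x - Real.log (Real.log x) - Real.eulerMascheroniConstant| ≤
      12 / Real.log x := by
  have hlog : 0 < Real.log x := Real.log_pos (by linarith)
  set n : ℕ := ⌊x⌋₊ with hn
  have hn2 : 2 ≤ n := Nat.le_floor (by exact_mod_cast hx)
  have hnx : x < n + 1 := Nat.lt_floor_add_one x
  -- `γ - B₁ = ∑_k d_k` and `A(x) - P(x) = ∑_{k ≤ n} d_k`
  have hconst : Real.eulerMascheroniConstant - meisselMertens = ∑' k, primeLogCoeffSubInv k := by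
    rw [tsum_primeLogCoeffSubInv, meisselMertens]
    ring
  have hsum := mertensLog_sub_primeRecipSum x
  obtain ⟨ht0, ht1⟩ := tsum_primeLogCoeffSubInv_sub_sum (n := n) (by omega)
  have hP := abs_primeRecipSum_sub_le hx
  -- `2/n ≤ 4/log x` (`n > x - 1 ≥ x/2 ≥ log x / 2`… we use `log x ≤ x ≤ 2n`)
  have htail : 2 / (n : ℝ) ≤ 4 / Real.log x := by
    have hn0 : (0 : ℝ) < n := by exact_mod_cast (show 0 < n by omega)
    have hxlog : Real.log x ≤ x := (Real.log_le_sub_one_of_pos (by linarith)).trans (by linarith)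
    rw [div_le_div_iff₀ hn0 hlog]
    have : x ≤ 2 * n := by
      have : (2 : ℝ) ≤ n := by exact_mod_cast hn2
      linarith
    nlinarith
  -- assemble: `A - loglog - γ = (P - loglog - B₁) - (∑_k d_k - ∑_{k≤n} d_k)`
  have hkey : Literature.NumberTheory.LFunctions.Nicolas.mertensLog x - Real.log (Real.log x) - Real.eulerMascheroniConstant =
      (primeRecipSum x - Real.log (Real.log x) - meisselMertens) -
        (∑' k, primeLogCoeffSubInv k - ∑ k ∈ Finset.range (n + 1), primeLogCoeffSubInv k) := by
    rw [← hsum]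
    linarith [hconst]
  rw [hkey]
  calc |(primeRecipSum x - Real.log (Real.log x) - meisselMertens) -
        (∑' k, primeLogCoeffSubInv k - ∑ k ∈ Finset.range (n + 1), primeLogCoeffSubInv k)|
      ≤ |primeRecipSum x - Real.log (Real.log x) - meisselMertens| +
        |∑' k, primeLogCoeffSubInv k - ∑ k ∈ Finset.range (n + 1), primeLogCoeffSubInv k| :=
        abs_sub _ _
    _ ≤ 8 / Real.log x + 4 / Real.log x :=
        add_le_add hP (by rw [abs_of_nonneg ht0]; exact ht1.trans htail)
    _ = 12 / Real.log x := by ring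

/-- `∏_{p≤x} (1 - 1/p)⁻¹ = exp(A(x))`, `A(x) = ∑_{p≤x} -log(1-1/p)`. [folklore] -/
theorem prod_one_sub_inv_inv_eq_exp (x : ℝ) :
    ∏ p ∈ Nat.primesLE ⌊x⌋₊, (1 - (p : ℝ)⁻¹)⁻¹ = Real.exp (Literature.NumberTheory.LFunctions.Nicolas.mertensLog x) := by
  rw [Literature.NumberTheory.LFunctions.Nicolas.mertensLog_eq_natCast_floor, Literature.NumberTheory.LFunctions.Nicolas.exp_mertensLog_natCast]

/-- **Mertens' product theorem, relative-error form**: for `x ≥ 2` with `log x ≥ 12`,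
`|∏_{p≤x} (1 - 1/p) · e^γ log x - 1| ≤ 24/log x`. [cite: HardyWright2008, Thm 429 (§22.8)] -/
theorem abs_prod_one_sub_inv_mul_log_sub_one_le {x : ℝ} (hx2 : 2 ≤ x) (hx : 12 ≤ Real.log x) :
    |(∏ p ∈ Nat.primesLE ⌊x⌋₊, (1 - (p : ℝ)⁻¹)) *
        (Real.exp Real.eulerMascheroniConstant * Real.log x) - 1| ≤ 24 / Real.log x := by
  have hlog : 0 < Real.log x := by linarith
  set E := Literature.NumberTheory.LFunctions.Nicolas.mertensLog x - Real.log (Real.log x) - Real.eulerMascheroniConstant with hE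
  have hEle : |E| ≤ 12 / Real.log x := abs_mertensLog_sub_le hx2
  have hE1 : |E| ≤ 1 := hEle.trans (by rw [div_le_one hlog]; exact hx)
  -- `∏ (1 - 1/p) = exp(-A) = exp(-E) / (e^γ log x)`
  have hprod : ∏ p ∈ Nat.primesLE ⌊x⌋₊, (1 - (p : ℝ)⁻¹) =
      Real.exp (-E) / (Real.exp Real.eulerMascheroniConstant * Real.log x) := by
    have h := prod_one_sub_inv_inv_eq_exp x
    rw [Finset.prod_inv_distrib] at h
    rw [← inv_inv (∏ p ∈ Nat.primesLE ⌊x⌋₊, (1 - (p : ℝ)⁻¹)), h, hE]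
    rw [show -(Literature.NumberTheory.LFunctions.Nicolas.mertensLog x - Real.log (Real.log x) - Real.eulerMascheroniConstant) =
      -Literature.NumberTheory.LFunctions.Nicolas.mertensLog x + Real.log (Real.log x) + Real.eulerMascheroniConstant by ring,
      Real.exp_add, Real.exp_add, Real.exp_log hlog, Real.exp_neg]
    field_simp
  rw [hprod, div_mul_cancel₀ _ (by positivity)]
  calc |Real.exp (-E) - 1| ≤ 2 * |-E| := Real.abs_exp_sub_one_le (by rwa [abs_neg])
    _ = 2 * |E| := by rw [abs_neg]
    _ ≤ 2 * (12 / Real.log x) := by gcongr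
    _ = 24 / Real.log x := by ring

/-- **Mertens's formula** (Nathanson, *Additive Number Theory: The Classical Bases*, Thm 6.8;
Mertens 1874; Hardy–Wright Thm 429): "For `x ≥ 2`, `∏_{p≤x} (1 - 1/p)⁻¹ = e^γ log x + O(1)`, where
`γ` is Euler's constant", i.e. there is `C` with `|∏_{p≤x} (1 - 1/p)⁻¹ - e^γ log x| ≤ C` for all
real `x ≥ 2`. (For `log x ≥ 12` the error is `≤ 24 e^γ`; on `[2, e^{12}]` both terms are bounded.)
[cite: Nathanson1996, Thm 6.8] -/
theorem mertens_formula :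
    ∃ C : ℝ, ∀ x : ℝ, 2 ≤ x →
      |(∏ p ∈ Nat.primesLE ⌊x⌋₊, (1 - (p : ℝ)⁻¹)⁻¹) -
          Real.exp Real.eulerMascheroniConstant * Real.log x| ≤ C := by
  set G := Real.exp Real.eulerMascheroniConstant with hG
  have hG0 : 0 < G := Real.exp_pos _
  set X : ℝ := Real.exp 48 with hX
  set P₀ : ℝ := Real.exp (Literature.NumberTheory.LFunctions.Nicolas.mertensLog X) with hP₀
  refine ⟨max (48 * G) (P₀ + G * 48), fun x hx ↦ ?_⟩
  have hlog : 0 < Real.log x := Real.log_pos (by linarith)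
  rcases le_or_gt 48 (Real.log x) with h48 | h48
  · -- large `x`: relative error `24/log x ≤ 1/2`
    refine le_trans ?_ (le_max_left _ _)
    have h := abs_prod_one_sub_inv_mul_log_sub_one_le hx (by linarith)
    set M := ∏ p ∈ Nat.primesLE ⌊x⌋₊, (1 - (p : ℝ)⁻¹) with hM
    have hMpos : 0 < M := by
      refine Finset.prod_pos fun p hp ↦ ?_
      have hp2 : (2 : ℝ) ≤ p := by exact_mod_cast (Nat.mem_primesLE.mp hp).2.two_le
      have : (p : ℝ)⁻¹ ≤ 1 / 2 := by
        rw [inv_eq_one_div]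
        exact one_div_le_one_div_of_le two_pos hp2
      linarith
    rw [Finset.prod_inv_distrib]
    change |M⁻¹ - G * Real.log x| ≤ 48 * G
    change |M * (G * Real.log x) - 1| ≤ 24 / Real.log x at h
    have h24 : 24 / Real.log x ≤ 1 / 2 := by
      rw [div_le_iff₀ hlog]
      linarith
    have hden : 1 / 2 ≤ M * (G * Real.log x) := by
      have := (abs_sub_le_iff.mp h).2
      linarith
    have hid : M⁻¹ - G * Real.log x = -(M * (G * Real.log x) - 1) / M := by
      field_simp
      ring
    rw [hid, abs_div, abs_neg, abs_of_pos hMpos, div_le_iff₀ hMpos]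
    calc |M * (G * Real.log x) - 1| ≤ 24 / Real.log x := h
      _ ≤ 48 * G * M := by
          rw [div_le_iff₀ hlog]
          linarith
  · -- small `x ≤ e^{48}`: both terms are bounded
    refine le_trans ?_ (le_max_right _ _)
    have hxX : x ≤ X := by
      rw [hX, ← Real.exp_log (show 0 < x by linarith)]
      exact Real.exp_le_exp.mpr h48.le
    have hP : ∏ p ∈ Nat.primesLE ⌊x⌋₊, (1 - (p : ℝ)⁻¹)⁻¹ ≤ P₀ := by
      rw [prod_one_sub_inv_inv_eq_exp, hP₀]
      exact Real.exp_le_exp.mpr (Literature.NumberTheory.LFunctions.Nicolas.mertensLog_mono hxX)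
    have hP0 : 0 ≤ ∏ p ∈ Nat.primesLE ⌊x⌋₊, (1 - (p : ℝ)⁻¹)⁻¹ := by
      rw [prod_one_sub_inv_inv_eq_exp]
      exact (Real.exp_pos _).le
    have hGL : 0 ≤ G * Real.log x := by positivity
    have hGL' : G * Real.log x ≤ G * 48 := by
      exact mul_le_mul_of_nonneg_left h48.le hG0.le
    rw [abs_le]
    constructor <;> linarith

end Literature.NumberTheory.LFunctions.Mertens
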